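import Mathlib
import Summits.CriticalPhenomena.CardyFormulaZ2.Theorems.CardyWhiteToColouredDriftBoundPlackettDefs
import Summits.CriticalPhenomena.CardyFormulaZ2.Theorems.CardyWhiteToColouredDriftBoundPlackettVar
import Summits.CriticalPhenomena.CardyFormulaZ2.Theorems.CardyWhiteToColouredDriftBoundPlackettWeights

/-!
# Plackett/Piterbarg drift identity for the noise heat flow: the normalised kernel family

Helper file for crux item `DriftBound` (stmt-CriticalPhenomena-4596) of route `CardyWhiteToColoured`
(`CardyFormulaZ2`), line `registered` (skeleton v4, lead c3), sub-goal `pl_normWeight_family` used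
by the stubs `stub_driftIdentity` / `stub_driftContinuous`: `C¹`-regularity in the width `σ > 0`
and a summable envelope, uniform for `σ` in a compact range `[a, b] ⊂ (0, ∞)`, of the
**variance-normalised kernels** `normWeight σ x e = q_σ(z_e) / √(v(σ))` of the smoothed lattice
white noise (`q_σ(z) = gaussWeight σ z = exp(−‖z‖²/(2σ²))`, `z_e = x − m_1 e`, `m_1 e` the medial
point of the edge `e` of `ℤ²`, `v(σ) = noiseVar σ x = ∑' e, q_σ(z_e)²`), as required by the
generic Plackett/Piterbarg drift identity for the weight family `G σ i e = normWeight σ (m i) e` of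
the normalised field `X̃^σ_i = ∑' e, G σ i e ξ_e`:

* the variance `v` is positive (`pl_noiseVar_pos'`) and differentiable on `(0, ∞)` with derivative
  `v'(σ) = ∑' e, 2 q̇_σ(z_e) q_σ(z_e)`, `q̇_σ(z) = (‖z‖²/σ³) q_σ(z)` (term-wise differentiation,
  `hasDerivAt_tsum_of_isPreconnected`, with the local envelope of `pl_gaussWeight_family` on
  `[σ/2, 2σ]`), and `v'` is continuous on `(0, ∞)` (`continuousOn_tsum`, same envelope);
* hence `σ ↦ normWeight σ x e` is differentiable at every `σ > 0` with derivative
  `q̇_σ(z_e)/√(v σ) − q_σ(z_e) v'(σ) / (2 √(v σ)³)` (quotient rule), continuous on `(0, ∞)`;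
* on `[a, b]`: `√(v σ) ≥ s₀ := q_a(z_{e₀}) > 0` (one term of the series, monotonicity of `q_σ` in
  `σ`), `0 ≤ v'(σ) ≤ V := ∑' e, u e` for the envelope `u` of `pl_gaussWeight_family x a b`, so both
  `|normWeight σ x e|` and `|∂_σ normWeight σ x e|` are at most `u e · (1/s₀ + V/(2 s₀³))`, a summable
  envelope.

References: S. Muirhead, H. Vanneuville, Ann. Inst. H. Poincaré Probab. Stat. 56 (2020), §2.1
(discretised white noise, kernel `q`); D. Beliaev, S. Muirhead, A. Rivera, Ann. Probab. 48 (2020),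
§2.2 (Piterbarg's formula: differentiating Gaussian functionals in a covariance parameter).
-/

noncomputable section

namespace Summit.CriticalPhenomena.CardyFormulaZ2.Cruxes.DriftBound.Birth

open Set Topology
open Literature.Probability.LatticeModels Literature.Probability.Percolation
open Summit.CriticalPhenomena.CardyFormulaZ2.Theorems.WhiteToColoured

/-! ### The kernel and its `σ`-derivative -/

/-- **`σ`-derivative of the squared kernel**: for `σ > 0`,
`d/ds|_{s=σ} q_s(z)² = 2 q̇_σ(z) q_σ(z)` with `q̇_σ(z) = (‖z‖²/σ³) q_σ(z)`
(`pw_hasDerivAt_gaussWeight` and the chain rule for the square). -/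
theorem nw_hasDerivAt_gaussWeight_sq {σ : ℝ} (hσ : 0 < σ) (z : ℂ) :
    HasDerivAt (fun s : ℝ => gaussWeight s z ^ 2)
      (2 * (‖z‖ ^ 2 / σ ^ 3 * gaussWeight σ z) * gaussWeight σ z) σ := by
  refine ((pw_hasDerivAt_gaussWeight hσ z).fun_pow 2).congr_deriv ?_
  simp only [Nat.cast_ofNat, Nat.add_one_sub_one, pow_one]
  ring

/-- The kernel `s ↦ q_s(z)` is continuous at every `σ > 0` (it is differentiable there). -/
theorem nw_continuousAt_gaussWeight {σ : ℝ} (hσ : 0 < σ) (z : ℂ) :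
    ContinuousAt (fun s : ℝ => gaussWeight s z) σ :=
  (pw_hasDerivAt_gaussWeight hσ z).continuousAt

/-- The `σ`-derivative `s ↦ q̇_s(z) = (‖z‖²/s³) q_s(z)` of the kernel is continuous at every
`σ > 0`. -/
theorem nw_continuousAt_dgaussWeight {σ : ℝ} (hσ : 0 < σ) (z : ℂ) :
    ContinuousAt (fun s : ℝ => ‖z‖ ^ 2 / s ^ 3 * gaussWeight s z) σ :=
  (continuousAt_const.div (continuousAt_id.pow 3) (pow_ne_zero 3 hσ.ne')).mul
    (nw_continuousAt_gaussWeight hσ z)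

/-! ### The variance `v(σ) = noiseVar σ x` is `C¹` on `(0, ∞)` -/

/-- **Term-wise differentiation of the variance**: for `σ > 0`, `s ↦ v(s) = ∑' e, q_s(z_e)²` has
derivative `v'(σ) = ∑' e, 2 q̇_σ(z_e) q_σ(z_e)` at `σ` (`hasDerivAt_tsum_of_isPreconnected` on the
neighbourhood `(σ/2, 2σ)`, the term-wise derivatives being dominated there by the summable envelope
of `pl_gaussWeight_family x (σ/2) (2σ)`, and the series converging at `σ` by
`pl_summable_gaussWeight_sq`). -/
theorem nw_hasDerivAt_noiseVar {σ : ℝ} (hσ : 0 < σ) (x : ℂ) :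
    HasDerivAt (fun s : ℝ => noiseVar s x)
      (∑' e : (zdGraph 2).edgeSet, 2 * (‖x - medialPoint 1 e.1‖ ^ 2 / σ ^ 3 *
        gaussWeight σ (x - medialPoint 1 e.1)) * gaussWeight σ (x - medialPoint 1 e.1)) σ := by
  have ha : 0 < σ / 2 := by positivity
  have hab : σ / 2 ≤ 2 * σ := by linarith
  obtain ⟨-, u, hu, hb⟩ := pl_gaussWeight_family x (σ / 2) (2 * σ) ha hab
  have hmem : σ ∈ Ioo (σ / 2) (2 * σ) := ⟨by linarith, by linarith⟩
  unfold noiseVar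
  refine hasDerivAt_tsum_of_isPreconnected
    (g := fun (e : (zdGraph 2).edgeSet) (s : ℝ) => gaussWeight s (x - medialPoint 1 e.1) ^ 2)
    (g' := fun (e : (zdGraph 2).edgeSet) (s : ℝ) => 2 * (‖x - medialPoint 1 e.1‖ ^ 2 / s ^ 3 *
      gaussWeight s (x - medialPoint 1 e.1)) * gaussWeight s (x - medialPoint 1 e.1))
    hu isOpen_Ioo isPreconnected_Ioo (fun e y hy => ?_) (fun e y hy => ?_) hmem
    (pl_summable_gaussWeight_sq hσ x) hmem
  · exact nw_hasDerivAt_gaussWeight_sq (ha.trans hy.1) _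
  · rw [Real.norm_eq_abs]
    exact (hb y (Ioo_subset_Icc_self hy) e).2.2

/-- The variance `σ ↦ v(σ)` is continuous on `(0, ∞)` (it is differentiable there). -/
theorem nw_continuousOn_noiseVar (x : ℂ) :
    ContinuousOn (fun σ : ℝ => noiseVar σ x) (Ioi 0) := fun σ hσ =>
  (nw_hasDerivAt_noiseVar (show 0 < σ from hσ) x).continuousAt.continuousWithinAt

/-- **Continuity of the derivative of the variance**: `σ ↦ v'(σ) = ∑' e, 2 q̇_σ(z_e) q_σ(z_e)` is
continuous on `(0, ∞)` (locally uniform convergence: `continuousOn_tsum` on each neighbourhood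
`(σ₀/2, 2σ₀)` with the envelope of `pl_gaussWeight_family x (σ₀/2) (2σ₀)`). -/
theorem nw_continuousOn_dnoiseVar (x : ℂ) :
    ContinuousOn (fun σ : ℝ => ∑' e : (zdGraph 2).edgeSet, 2 * (‖x - medialPoint 1 e.1‖ ^ 2 / σ ^ 3 *
        gaussWeight σ (x - medialPoint 1 e.1)) * gaussWeight σ (x - medialPoint 1 e.1)) (Ioi 0) := by
  intro σ₀ hσ₀
  replace hσ₀ : 0 < σ₀ := hσ₀
  have ha : 0 < σ₀ / 2 := by positivity
  have hab : σ₀ / 2 ≤ 2 * σ₀ := by linarith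
  obtain ⟨-, u, hu, hb⟩ := pl_gaussWeight_family x (σ₀ / 2) (2 * σ₀) ha hab
  have hmem : Ioo (σ₀ / 2) (2 * σ₀) ∈ 𝓝 σ₀ := Ioo_mem_nhds (by linarith) (by linarith)
  refine (ContinuousOn.continuousAt ?_ hmem).continuousWithinAt
  refine continuousOn_tsum (fun e => ?_) hu (fun e y hy => ?_)
  · intro y hy
    have hy0 : 0 < y := ha.trans hy.1
    exact (((nw_continuousAt_dgaussWeight hy0 _).const_mul 2).mul
      (nw_continuousAt_gaussWeight hy0 _)).continuousWithinAt
  · rw [Real.norm_eq_abs]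
    exact (hb y (Ioo_subset_Icc_self hy) e).2.2

/-- **On `[a, ∞)` the variance is bounded below by one term of the series at width `a`**:
`q_a(z_{e₀})² ≤ q_σ(z_{e₀})² ≤ v(σ)` for `0 < a ≤ σ` (monotonicity of the kernel in the width,
`pa_gaussWeight_mono`, and `Summable.le_tsum` for the nonnegative series `v`). -/
theorem nw_sq_le_noiseVar {a σ : ℝ} (ha : 0 < a) (haσ : a ≤ σ) (x : ℂ) (e₀ : (zdGraph 2).edgeSet) :
    gaussWeight a (x - medialPoint 1 e₀.1) ^ 2 ≤ noiseVar σ x := by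
  have hσ : 0 < σ := lt_of_lt_of_le ha haσ
  calc gaussWeight a (x - medialPoint 1 e₀.1) ^ 2
      ≤ gaussWeight σ (x - medialPoint 1 e₀.1) ^ 2 := by
        gcongr
        · exact (gaussWeight_pos _ _).le
        · exact pa_gaussWeight_mono ha haσ _
    _ ≤ noiseVar σ x := by
        unfold noiseVar
        exact (pl_summable_gaussWeight_sq hσ x).le_tsum e₀ (fun e _ => sq_nonneg _)

/-! ### The normalised kernel is `C¹` on `(0, ∞)` -/

/-- **Quotient rule for the normalised kernel**: for `σ > 0`, `s ↦ normWeight s x e = q_s(z_e)/√(v s)`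
has derivative `q̇_σ(z_e)/√(v σ) − q_σ(z_e) v'(σ) / (2 √(v σ)³)` at `σ` (`HasDerivAt.div`,
`HasDerivAt.sqrt`, `v σ > 0`). -/
theorem nw_hasDerivAt_normWeight {σ : ℝ} (hσ : 0 < σ) (x : ℂ) (e : (zdGraph 2).edgeSet) :
    HasDerivAt (fun s : ℝ => normWeight s x e)
      (‖x - medialPoint 1 e.1‖ ^ 2 / σ ^ 3 * gaussWeight σ (x - medialPoint 1 e.1) /
          Real.sqrt (noiseVar σ x) -
        gaussWeight σ (x - medialPoint 1 e.1) *
          (∑' e' : (zdGraph 2).edgeSet, 2 * (‖x - medialPoint 1 e'.1‖ ^ 2 / σ ^ 3 *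
            gaussWeight σ (x - medialPoint 1 e'.1)) * gaussWeight σ (x - medialPoint 1 e'.1)) /
          (2 * Real.sqrt (noiseVar σ x) ^ 3)) σ := by
  have hv := nw_hasDerivAt_noiseVar hσ x
  have hvpos : 0 < noiseVar σ x := pl_noiseVar_pos' hσ x
  have hs : 0 < Real.sqrt (noiseVar σ x) := Real.sqrt_pos.2 hvpos
  have h := (pw_hasDerivAt_gaussWeight hσ (x - medialPoint 1 e.1)).div (hv.sqrt hvpos.ne') hs.ne'
  unfold normWeight
  refine h.congr_deriv ?_
  field_simp

/-- **Continuity of the `σ`-derivative of the normalised kernel**: the closed form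
`σ ↦ q̇_σ(z_e)/√(v σ) − q_σ(z_e) v'(σ) / (2 √(v σ)³)` of `nw_hasDerivAt_normWeight` is continuous
on `(0, ∞)` (continuity of `q`, `q̇`, `v`, `v'` there and `√(v σ) > 0`). -/
theorem nw_continuousOn_dnormWeight (x : ℂ) (e : (zdGraph 2).edgeSet) :
    ContinuousOn (fun σ : ℝ =>
      ‖x - medialPoint 1 e.1‖ ^ 2 / σ ^ 3 * gaussWeight σ (x - medialPoint 1 e.1) /
          Real.sqrt (noiseVar σ x) -
        gaussWeight σ (x - medialPoint 1 e.1) *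
          (∑' e' : (zdGraph 2).edgeSet, 2 * (‖x - medialPoint 1 e'.1‖ ^ 2 / σ ^ 3 *
            gaussWeight σ (x - medialPoint 1 e'.1)) * gaussWeight σ (x - medialPoint 1 e'.1)) /
          (2 * Real.sqrt (noiseVar σ x) ^ 3)) (Ioi 0) := by
  have hw : ContinuousOn (fun σ : ℝ => gaussWeight σ (x - medialPoint 1 e.1)) (Ioi 0) :=
    fun σ hσ => (nw_continuousAt_gaussWeight (show 0 < σ from hσ) _).continuousWithinAt
  have hdw : ContinuousOn (fun σ : ℝ => ‖x - medialPoint 1 e.1‖ ^ 2 / σ ^ 3 *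
      gaussWeight σ (x - medialPoint 1 e.1)) (Ioi 0) :=
    fun σ hσ => (nw_continuousAt_dgaussWeight (show 0 < σ from hσ) _).continuousWithinAt
  have hsq : ContinuousOn (fun σ : ℝ => Real.sqrt (noiseVar σ x)) (Ioi 0) :=
    (nw_continuousOn_noiseVar x).sqrt
  have hsq0 : ∀ σ ∈ Ioi (0 : ℝ), Real.sqrt (noiseVar σ x) ≠ 0 := fun σ hσ =>
    (Real.sqrt_pos.2 (pl_noiseVar_pos' (show 0 < σ from hσ) x)).ne'
  refine (hdw.div hsq hsq0).sub ((hw.mul (nw_continuousOn_dnoiseVar x)).div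
    (continuousOn_const.mul (hsq.pow 3)) fun σ hσ => ?_)
  exact mul_ne_zero two_ne_zero (pow_ne_zero 3 (hsq0 σ hσ))

/-! ### The envelope -/

/-- **The elementary inequality behind the envelope.** If `0 ≤ A, B ≤ U`, `0 ≤ D ≤ V` and
`0 < s₀ ≤ s`, then `|B/s|` and `|A/s − B D/(2 s³)|` are both at most `U (1/s₀ + V/(2 s₀³))`. Applied
with `A = q̇_σ(z_e)`, `B = q_σ(z_e)`, `U = u e`, `D = v'(σ)`, `s = √(v σ)`. -/
theorem nw_abs_quot_le {A B U D V s s₀ : ℝ} (hA : 0 ≤ A) (hAU : A ≤ U) (hB : 0 ≤ B) (hBU : B ≤ U)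
    (hD : 0 ≤ D) (hDV : D ≤ V) (hs₀ : 0 < s₀) (hs : s₀ ≤ s) :
    |B / s| ≤ U * (1 / s₀ + V / (2 * s₀ ^ 3)) ∧
      |A / s - B * D / (2 * s ^ 3)| ≤ U * (1 / s₀ + V / (2 * s₀ ^ 3)) := by
  have hs' : 0 < s := lt_of_lt_of_le hs₀ hs
  have hU : 0 ≤ U := hA.trans hAU
  have hV : 0 ≤ V := hD.trans hDV
  have h1 : B / s ≤ U / s₀ := div_le_div₀ hU hBU hs₀ hs
  have h2 : A / s ≤ U / s₀ := div_le_div₀ hU hAU hs₀ hs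
  have h3 : B * D / (2 * s ^ 3) ≤ U * V / (2 * s₀ ^ 3) :=
    div_le_div₀ (by positivity) (mul_le_mul hBU hDV hD hU) (by positivity) (by gcongr)
  have h4 : 0 ≤ U * V / (2 * s₀ ^ 3) := by positivity
  have hkey : U / s₀ + U * V / (2 * s₀ ^ 3) = U * (1 / s₀ + V / (2 * s₀ ^ 3)) := by ring
  constructor
  · rw [abs_of_nonneg (div_nonneg hB hs'.le)]
    linarith
  · have h5 : |A / s - B * D / (2 * s ^ 3)| ≤ A / s + B * D / (2 * s ^ 3) := by
      have ha' : 0 ≤ A / s := div_nonneg hA hs'.le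
      have hb' : 0 ≤ B * D / (2 * s ^ 3) := by positivity
      rw [abs_le]
      constructor <;> linarith
    linarith

/-! ### The registered sub-goal -/

/-- **The normalised kernel family of the smoothed lattice white noise (registered form).** For
`x ∈ ℂ` and widths `0 < a ≤ b`: (i) the variance `noiseVar σ x` is positive for every `σ > 0`
(`pl_noiseVar_pos'`); (ii) for every edge `e`, `s ↦ normWeight s x e` is differentiable at every
`σ > 0` (`nw_hasDerivAt_normWeight`); (iii) its derivative `σ ↦ deriv (normWeight · x e) σ` is
continuous on `(0, ∞)` (it agrees there with the closed form of `nw_hasDerivAt_normWeight`, which is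
continuous by `nw_continuousOn_dnormWeight`); (iv) the envelope `u' e = u e · (1/s₀ + V/(2 s₀³))`,
with `u` the envelope of `pl_gaussWeight_family x a b`, `V = ∑' e, u e` and `s₀ = q_a(z_{e₀})` for a
fixed edge `e₀` (`pl_edgeSet_nonempty`), is summable and dominates `|normWeight σ x e|` and
`|deriv (normWeight · x e) σ|` for all `σ ∈ [a, b]` and all edges `e` (`nw_abs_quot_le` with
`√(v σ) ≥ s₀` from `nw_sq_le_noiseVar` and `0 ≤ v'(σ) ≤ V` by term-wise comparison). -/
theorem pl_normWeight_family : ∀ (x : ℂ) (a b : ℝ), 0 < a → a ≤ b → (∀ σ : ℝ, 0 < σ → 0 < Summit.CriticalPhenomena.CardyFormulaZ2.Cruxes.DriftBound.Birth.noiseVar σ x) ∧ (∀ (e : (Literature.Probability.LatticeModels.zdGraph 2).edgeSet) (σ : ℝ), 0 < σ → DifferentiableAt ℝ (fun s : ℝ => Summit.CriticalPhenomena.CardyFormulaZ2.Cruxes.DriftBound.Birth.normWeight s x e) σ) ∧ (∀ e : (Literature.Probability.LatticeModels.zdGraph 2).edgeSet, ContinuousOn (fun σ : ℝ => deriv (fun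 s : ℝ => Summit.CriticalPhenomena.CardyFormulaZ2.Cruxes.DriftBound.Birth.normWeight s x e) σ) (Set.Ioi 0)) ∧ ∃ u : (Literature.Probability.LatticeModels.zdGraph 2).edgeSet → ℝ, Summable u ∧ ∀ σ ∈ Set.Icc a b, ∀ e : (Literature.Probability.LatticeModels.zdGraph 2).edgeSet, |Summit.CriticalPhenomena.CardyFormulaZ2.Cruxes.DriftBound.Birth.normWeight σ x e| ≤ u e ∧ |deriv (fun s : ℝ => Summit.CriticalPhenomena.CardyFormulaZ2.Cruxes.DriftBound.Birth.normWeight s x e) σ| ≤ u e := by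
  intro x a b ha hab
  refine ⟨fun σ hσ => pl_noiseVar_pos' hσ x,
    fun e σ hσ => (nw_hasDerivAt_normWeight hσ x e).differentiableAt,
    fun e => (nw_continuousOn_dnormWeight x e).congr fun σ hσ =>
      (nw_hasDerivAt_normWeight (show 0 < σ from hσ) x e).deriv, ?_⟩
  -- the envelope `u' e = u e * C`, `C = 1/s₀ + V/(2 s₀³)`
  obtain ⟨-, u, hu, hbd⟩ := pl_gaussWeight_family x a b ha hab
  obtain ⟨e₀⟩ := pl_edgeSet_nonempty
  set s₀ : ℝ := gaussWeight a (x - medialPoint 1 e₀.1) with hs₀def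
  set V : ℝ := ∑' e : (zdGraph 2).edgeSet, u e with hVdef
  refine ⟨fun e => u e * (1 / s₀ + V / (2 * s₀ ^ 3)), hu.mul_right _, ?_⟩
  rintro σ ⟨haσ, hσb⟩ e
  have hσ : 0 < σ := lt_of_lt_of_le ha haσ
  have hσab : σ ∈ Icc a b := ⟨haσ, hσb⟩
  -- `s₀ ≤ √(v σ)`
  have hs₀ : 0 < s₀ := gaussWeight_pos _ _
  have hs : s₀ ≤ Real.sqrt (noiseVar σ x) :=
    Real.le_sqrt_of_sq_le (nw_sq_le_noiseVar ha haσ x e₀)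
  -- `0 ≤ v'(σ) ≤ V`
  have hnn : ∀ e' : (zdGraph 2).edgeSet, 0 ≤ 2 * (‖x - medialPoint 1 e'.1‖ ^ 2 / σ ^ 3 *
      gaussWeight σ (x - medialPoint 1 e'.1)) * gaussWeight σ (x - medialPoint 1 e'.1) := fun e' =>
    mul_nonneg (mul_nonneg zero_le_two (mul_nonneg (div_nonneg (sq_nonneg _)
      (pow_nonneg hσ.le 3)) (gaussWeight_pos _ _).le)) (gaussWeight_pos _ _).le
  have hle : ∀ e' : (zdGraph 2).edgeSet, 2 * (‖x - medialPoint 1 e'.1‖ ^ 2 / σ ^ 3 *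
      gaussWeight σ (x - medialPoint 1 e'.1)) * gaussWeight σ (x - medialPoint 1 e'.1) ≤ u e' :=
    fun e' => (le_abs_self _).trans (hbd σ hσab e').2.2
  have hD : 0 ≤ ∑' e' : (zdGraph 2).edgeSet, 2 * (‖x - medialPoint 1 e'.1‖ ^ 2 / σ ^ 3 *
      gaussWeight σ (x - medialPoint 1 e'.1)) * gaussWeight σ (x - medialPoint 1 e'.1) :=
    tsum_nonneg hnn
  have hDV : ∑' e' : (zdGraph 2).edgeSet, 2 * (‖x - medialPoint 1 e'.1‖ ^ 2 / σ ^ 3 *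
      gaussWeight σ (x - medialPoint 1 e'.1)) * gaussWeight σ (x - medialPoint 1 e'.1) ≤ V :=
    (Summable.of_nonneg_of_le hnn hle hu).tsum_le_tsum hle hu
  -- `0 ≤ q̇, q ≤ u e`
  have hA : 0 ≤ ‖x - medialPoint 1 e.1‖ ^ 2 / σ ^ 3 * gaussWeight σ (x - medialPoint 1 e.1) :=
    mul_nonneg (div_nonneg (sq_nonneg _) (pow_nonneg hσ.le 3)) (gaussWeight_pos _ _).le
  have hAU : ‖x - medialPoint 1 e.1‖ ^ 2 / σ ^ 3 * gaussWeight σ (x - medialPoint 1 e.1) ≤ u e :=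
    (le_abs_self _).trans (hbd σ hσab e).2.1
  have hB : 0 ≤ gaussWeight σ (x - medialPoint 1 e.1) := (gaussWeight_pos _ _).le
  have hBU : gaussWeight σ (x - medialPoint 1 e.1) ≤ u e := (le_abs_self _).trans (hbd σ hσab e).1
  obtain ⟨h1, h2⟩ := nw_abs_quot_le hA hAU hB hBU hD hDV hs₀ hs
  refine ⟨?_, ?_⟩
  · unfold normWeight
    exact h1
  · rw [(nw_hasDerivAt_normWeight hσ x e).deriv]
    exact h2

end Summit.CriticalPhenomena.CardyFormulaZ2.Cruxes.DriftBound.Birth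

end
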